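import Mathlib
import Summits.Ventures.PercRepro2.PMK5Deg5LocusSplit

/-!
# THE MAXIMAL DEGENERATE FACES OF `K₆` — PART 3: THE NINETEEN CONFIGURATION COUNTS OF THE FACE `15863` BY EIGHTHS,
AND THE VANISHING OF THE CRUX FUNCTIONAL AT ITS CENTRE (blind cell PercRepro2, mine-2 g32)

The maximal face `15863` = `K₆` minus {ob ub ba₃} (12 edges, `4096` configurations — too
many for one kernel count under the verify nodes' memory cap): its nineteen counts `cntV 15863 i = #{ω ⊆ M : tab i ω}`
are computed in the 4 eighths of the count tree that the edge set allows (`cnt1E`, `PMK5Deg5LocusSplit.lean`,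
`512` leaves each, one `decide +kernel` each), assembled by `cnt1_eq_eighths`; then `KposV (cntV 15863) = KnegV (cntV 15863)`
(`= 22096800`) by arithmetic on the literals — so `Gc` vanishes at the centre of `15863` (`gc15_centre_zero`) and on the
whole face (`gc15_zero_of_centre`).  Standard axioms.
-/

namespace Summit.Ventures.PercRepro2

namespace Deg5

namespace Locus

set_option maxHeartbeats 0 in
set_option maxRecDepth 100000 in
/-- The eighth `(false, false, false)` of the nineteen counts of the face `15863`. -/
theorem cntE_15863_000 : ∀ i : Fin 19, cnt1E (tab i) 15863 false false false = ![174, 60, 36, 46, 46, 38, 38, 34, 34, 58, 58, 84, 54, 96, 18, 84, 18, 24, 40] i := by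
  decide +kernel

set_option maxHeartbeats 0 in
set_option maxRecDepth 100000 in
/-- The eighth `(false, false, true)` of the nineteen counts of the face `15863`. -/
theorem cntE_15863_001 : ∀ i : Fin 19, cnt1E (tab i) 15863 false false true = ![78, 0, 0, 22, 22, 26, 26, 22, 22, 26, 26, 18, 48, 0, 78, 0, 66, 0, 0] i := by
  decide +kernel

set_option maxHeartbeats 0 in
set_option maxRecDepth 100000 in
/-- The eighth `(false, true, false)` of the nineteen counts of the face `15863`. -/
theorem cntE_15863_010 : ∀ i : Fin 19, cnt1E (tab i) 15863 false true false = ![144, 18, 6, 40, 40, 42, 42, 38, 38, 48, 48, 78, 42, 90, 36, 81, 33, 4, 12] i := by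
  decide +kernel

set_option maxHeartbeats 0 in
set_option maxRecDepth 100000 in
/-- The eighth `(false, true, true)` of the nineteen counts of the face `15863`. -/
theorem cntE_15863_011 : ∀ i : Fin 19, cnt1E (tab i) 15863 false true true = ![54, 0, 0, 16, 16, 18, 18, 16, 16, 18, 18, 6, 42, 0, 54, 0, 48, 0, 0] i := by
  decide +kernel

/-- The nineteen configuration counts of the maximal face `15863`, assembled from its eighths. -/
theorem cntV_15863 : ∀ i : Fin 19, cntV 15863 i = ![450, 78, 42, 124, 124, 124, 124, 110, 110, 150, 150, 186, 186, 186, 186, 165, 165, 28, 52] i := by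
  intro i
  unfold cntV
  rw [cnt1_eq_eighths]
  simp only [if_pos (show Nat.testBit 15863 12 = true by decide), if_pos (show Nat.testBit 15863 13 = true by decide), if_neg (show ¬ Nat.testBit 15863 14 = true by decide), cntE_15863_000, cntE_15863_001, cntE_15863_010, cntE_15863_011, add_zero]
  fin_cases i <;> rfl

/-- The maximal face `15863`: equal positive and negative monomial sums. -/
theorem zero_15863 : KposV (cntV 15863) = KnegV (cntV 15863) := by
  rw [funext cntV_15863]
  decide

end Locus

end Deg5

end Summit.Ventures.PercRepro2
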